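import Literature.AlgebraicGeometry.Motives.ProetCohomologyExactSequence
import Literature.Algebra.InverseSystem.AddInverseLimit
import HarnessLib

/-!
# Finiteness of `ℓ`-adic cohomology, V: the product coefficient sequence
# `0 → ℤ_ℓ → ∏_m ℤ/ℓᵐ —(1 - shift)→ ∏_m ℤ/ℓᵐ → 0` is a continuous short exact sequence

The `lim¹` exact sequences `0 → lim¹_m Hⁱ(Y, ℤ/ℓᵐ) → Hⁱ⁺¹_proét(Y, ℤ_ℓ) → lim_m Hⁱ⁺¹(Y, ℤ/ℓᵐ) → 0`
(Bhatt–Scholze Prop. 5.6.2; the named fact `ellAdicCohomology_limOneSequence` of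
`EllAdicComparison.lean`, with étale groups inside the limits) are, in the pro-étale world, the
long exact cohomology sequence of a short exact sequence of *sheaves*
`0 → lim_n F_n → ∏_n F_n —(t - id)→ ∏_n F_n → 0` (proof of Prop. 3.1.10), combined with the
commutation of cohomology with countable products (Prop. 3.1.9, repleteness). For the tower
`F_n = F_{ℤ/ℓⁿ} = (U ↦ C(U, ℤ/ℓⁿ))` on `X_proét`, with `lim_n F_{ℤ/ℓⁿ} = F_{ℤ_ℓ}` (Lemma 6.8.2 (1)) and
`∏_n F_{ℤ/ℓⁿ} = F_{∏ ℤ/ℓⁿ}` (continuous maps to a product), the sheaf sequence is the one attached by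
`ProetCohomologyExactSequence.lean` (`proetSheafShortComplex`, `proetSheaf_shortExact`) to the
sequence of topological groups `0 → ℤ_ℓ —ι→ ∏_m ℤ/ℓᵐ —τ→ ∏_m ℤ/ℓᵐ → 0`, `ι a = (a mod ℓᵐ)_m`,
`τ = id - shift`. This file PROVES that this sequence of groups is a continuous short exact
sequence in the sense of `IsContinuousShortExact` (`isContinuousShortExact_toZModPowProd`):

* `ι = toZModPowProd ℓ` is continuous, injective and a closed embedding (compact source), with
  image `ker τ = lim_m ℤ/ℓᵐ` (`Literature.Algebra.InverseSystem.padicIntToLimit_surjective`: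
  `ℤ_ℓ = lim_m ℤ/ℓᵐ`);
* `τ = prodTowerDiff ℓ = towerDiff (zmodPowTransition ℓ)` is continuous and — the point — admits a
  CONTINUOUS SET-THEORETIC SECTION (`prodTowerSection`: `x₀ := 0`, `x_{m+1} := s(x_m - a_m)` along
  set-theoretic sections `s` of the surjections of discrete groups `ℤ/ℓᵐ⁺¹ → ℤ/ℓᵐ`); in particular
  `τ` is surjective, i.e. `lim¹_m ℤ/ℓᵐ = 0`, the elementary case of "surjective transition maps
  make `t - id : ∏ F_n → ∏ F_n` onto" (proof of Prop. 3.1.10) — here no repleteness is involved.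

Hence (`prodShortComplex_shortExact`) `0 → F_{ℤ_ℓ} → F_{∏ℤ/ℓᵐ} → F_{∏ℤ/ℓᵐ} → 0` is a short exact
sequence of abelian sheaves on `X_proét` for Mathlib's pro-étale site, unconditionally, and the
long exact cohomology sequence with its connecting homomorphism is available from
`ProetCohomologyExactSequence.lean` (`ProetCohomology.δ`, `exact₁/₂/₃`); the `lim¹` sequence
modulo the commutation of `Hⁱ(X_proét, –)` with countable products is `ProetLimOneSequence.lean`.

## References

* B. Bhatt, P. Scholze, *The pro-étale topology for schemes*, Astérisque 369 (2015) (held: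
  arXiv:1309.1198): Prop. 3.1.10 and its proof (`R lim F_n → ∏ F_n —(t-id)→ ∏ F_n`; surjective
  transitions make `t - id` onto), Lemma 4.2.12, Prop. 5.6.2, Def. 6.8.1, Lemma 6.8.2 (1)
  (`Map_cont(S, 𝓞_E) = lim_n Map_cont(S, 𝓞_E/ϖⁿ)`). [BhattScholze2015]
* J. S. Milne, *Étale cohomology* (2025 reissue, held copy), V §1 p. 176 (the tower `(ℤ/ℓⁿ)_n`,
  `ℤ_ℓ = lim ℤ/(ℓⁿ)`). [Milne2025]

## Design notes

* `∏_m ℤ/ℓᵐ` is the Pi type `ZModPowProd ℓ = ∀ m, ZMod (ℓ ^ m)` with the product topology.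
* `τ` is literally `towerDiff` (`EllAdicComparison.lean`) of the reductions
  `Literature.Algebra.InverseSystem.zmodPowTransition`, so that on `∏_m Hⁱ(X_proét, ℤ/ℓᵐ)` its kernel
  and cokernel are the `towerLim`/`TowerLimOne` of that file; note `towerDiff` is `id - t`
  (`(a_m) ↦ (a_m - red a_{m+1})`), the negative of Bhatt–Scholze's `t - id` (same kernel and image).
* Literature prior art reused (not restated): `IsContinuousShortExact`, `proetSheafShortComplex`,
  `proetSheaf_shortExact` (`ProetCohomologyExactSequence.lean`); `zmodPowTransition`, `zmodPowLimit`,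
  `padicIntToLimit` with `_injective`/`_surjective` (`Literature/Algebra/InverseSystem/AddInverseLimit.lean`;
  `ι` is `padicIntToLimit` followed by the subgroup inclusion); `compatSeqSubring`
  (`TateModuleProofs.lean`) is the ring version of `zmodPowLimit`, not needed here. Mathlib searches:
  `PadicInt.ext_of_toZModPow`, `PadicInt.cast_toZModPow`, `ZMod.ringHom_surjective`,
  `Function.surjInv`, `Continuous.isClosedEmbedding` (used).
-/

universe u

open CategoryTheory AlgebraicGeometry Literature.Algebra.InverseSystem

noncomputable section

namespace Literature.AlgebraicGeometry.Motives

section Coefficients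

variable (ℓ : ℕ)

/-- The product group `∏_m ℤ/ℓᵐ` (`m ≥ 0`) with its product topology, each factor `ZMod (ℓ ^ m)`
discrete; for `ℓ ≥ 1` a compact Hausdorff abelian group (for `ℓ` prime it contains
`ℤ_ℓ = lim_m ℤ/ℓᵐ` as the closed subgroup of compatible families). [folklore] -/
abbrev ZModPowProd : Type := ∀ m : ℕ, ZMod (ℓ ^ m)

/-- The endomorphism `τ : (a_m)_m ↦ (a_m - red(a_{m+1}))_m` of `∏_m ℤ/ℓᵐ`: `towerDiff`
(`EllAdicComparison.lean`) of the reductions `zmodPowTransition ℓ`; its kernel is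
`lim_m ℤ/ℓᵐ = zmodPowLimit ℓ` and its cokernel `lim¹_m ℤ/ℓᵐ` (which vanishes,
`prodTowerDiff_prodTowerSection`). It is `id - t`, the negative of the map `t - id` of
Bhatt–Scholze Prop. 3.1.10 for the tower of groups `ℤ/ℓᵐ` (same kernel and image).
[cite: BhattScholze2015, Prop. 3.1.10] -/
abbrev prodTowerDiff : ZModPowProd ℓ →+ ZModPowProd ℓ :=
  towerDiff (A := fun m => ZMod (ℓ ^ m)) (zmodPowTransition ℓ)

/-- `τ` is continuous (each component is a difference of continuous projections, the factors
being discrete). [folklore] -/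
theorem continuous_prodTowerDiff : Continuous (prodTowerDiff ℓ) :=
  continuous_pi fun m => (continuous_apply m).sub
    ((continuous_of_discreteTopology (f := zmodPowTransition ℓ m)).comp (continuous_apply (m + 1)))

/-- A set-theoretic section of `τ`, by recursion: `x₀ := 0`, `x_{m+1} := s(x_m - a_m)` for a
set-theoretic section `s` (`Function.surjInv`) of the surjection `ℤ/ℓᵐ⁺¹ → ℤ/ℓᵐ`
(`ZMod.ringHom_surjective`). [folklore] -/
def prodTowerSection (a : ZModPowProd ℓ) : ∀ m : ℕ, ZMod (ℓ ^ m)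
  | 0 => 0
  | m + 1 => Function.surjInv (ZMod.ringHom_surjective
      (ZMod.castHom (pow_dvd_pow ℓ m.le_succ) (ZMod (ℓ ^ m)))) (prodTowerSection a m - a m)

/-- The components of `prodTowerSection` are continuous (induction: `x_{m+1}` is a function,
continuous since the groups are discrete, of the continuous `x_m - a_m`), hence so is
`prodTowerSection : ∏ ℤ/ℓᵐ → ∏ ℤ/ℓᵐ`. [folklore] -/
theorem continuous_prodTowerSection : Continuous (prodTowerSection ℓ) := by
  refine continuous_pi fun m => ?_
  induction m with
  | zero => exact continuous_const
  | succ m ih =>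
    change Continuous fun a => Function.surjInv _ (prodTowerSection ℓ a m - a m)
    exact (continuous_of_discreteTopology : Continuous (Function.surjInv (ZMod.ringHom_surjective
      (ZMod.castHom (pow_dvd_pow ℓ m.le_succ) (ZMod (ℓ ^ m)))))).comp (ih.sub (continuous_apply m))

/-- `τ ∘ prodTowerSection = id`: `x_m - red(x_{m+1}) = x_m - (x_m - a_m) = a_m`. In particular `τ`
is surjective (`lim¹_m ℤ/ℓᵐ = 0`; Bhatt–Scholze, proof of Prop. 3.1.10: surjective transition maps
make `t - id` onto). [cite: BhattScholze2015, Prop. 3.1.10 (proof)] -/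
theorem prodTowerDiff_prodTowerSection (a : ZModPowProd ℓ) :
    prodTowerDiff ℓ (prodTowerSection ℓ a) = a := by
  funext m
  rw [towerDiff_apply, zmodPowTransition_apply]
  change prodTowerSection ℓ a m - ZMod.castHom (pow_dvd_pow ℓ m.le_succ) (ZMod (ℓ ^ m))
    (Function.surjInv _ (prodTowerSection ℓ a m - a m)) = a m
  rw [Function.surjInv_eq (ZMod.ringHom_surjective (ZMod.castHom (pow_dvd_pow ℓ m.le_succ)
    (ZMod (ℓ ^ m)))) (prodTowerSection ℓ a m - a m)]
  abel

variable [Fact ℓ.Prime]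

/-- The diagonal embedding `ι : ℤ_ℓ → ∏_m ℤ/ℓᵐ`, `a ↦ (a mod ℓᵐ)_m`: the canonical map
`padicIntToLimit ℓ : ℤ_ℓ → lim_m ℤ/ℓᵐ` of `AddInverseLimit.lean` followed by the inclusion of the
subgroup `zmodPowLimit ℓ ⊆ ∏_m ℤ/ℓᵐ` (Bhatt–Scholze Lemma 6.8.2 (1): `𝓞_{E,X} = lim_n 𝓞_E/ϖⁿ`,
pointwise). [cite: BhattScholze2015, Lemma 6.8.2] -/
def toZModPowProd : ℤ_[ℓ] →+ ZModPowProd ℓ :=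
  (zmodPowLimit ℓ).subtype.comp (padicIntToLimit ℓ)

/-- Components of `ι` are the reductions `PadicInt.toZModPow m` (definitional). [folklore] -/
@[simp] theorem toZModPowProd_apply (a : ℤ_[ℓ]) (m : ℕ) :
    toZModPowProd ℓ a m = PadicInt.toZModPow m a := rfl

/-- `ι` is continuous (each reduction is, `continuous_reductionHom`). [folklore] -/
theorem continuous_toZModPowProd : Continuous (toZModPowProd ℓ) :=
  continuous_pi fun m => continuous_reductionHom ℓ m

/-- `ι` is injective (`padicIntToLimit_injective`: an `ℓ`-adic integer is determined by its
reductions). [folklore] -/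
theorem toZModPowProd_injective : Function.Injective (toZModPowProd ℓ) :=
  Subtype.val_injective.comp (padicIntToLimit_injective ℓ)

/-- `τ ∘ ι = 0`: the reductions of an `ℓ`-adic integer are compatible. [folklore] -/
theorem prodTowerDiff_comp_toZModPowProd : (prodTowerDiff ℓ).comp (toZModPowProd ℓ) = 0 := by
  ext a m
  simp [PadicInt.cast_toZModPow m (m + 1) m.le_succ]

/-- **`ℤ_ℓ = lim_m ℤ/ℓᵐ`**: `ker τ ⊆ im ι`, i.e. a compatible family of residues is the family of
residues of an `ℓ`-adic integer (`padicIntToLimit_surjective`). [folklore] -/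
theorem exists_toZModPowProd_eq_of_prodTowerDiff_eq_zero {a : ZModPowProd ℓ}
    (ha : prodTowerDiff ℓ a = 0) : ∃ x : ℤ_[ℓ], toZModPowProd ℓ x = a := by
  have ha' : a ∈ zmodPowLimit ℓ := (mem_addInverseLimit_iff a).2 fun m =>
    (sub_eq_zero.1 (congr_fun ha m)).symm
  obtain ⟨x, hx⟩ := padicIntToLimit_surjective ℓ ⟨a, ha'⟩
  exact ⟨x, congrArg Subtype.val hx⟩

/-- **`0 → ℤ_ℓ —ι→ ∏_m ℤ/ℓᵐ —τ→ ∏_m ℤ/ℓᵐ → 0` is a continuous short exact sequence**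
(`IsContinuousShortExact`): `ι` continuous, injective and inducing (a continuous injection from
the compact `ℤ_ℓ` to a Hausdorff space is a closed embedding), `im ι = ker τ`
(`exists_toZModPowProd_eq_of_prodTowerDiff_eq_zero`), and `τ` continuous with the continuous
set-theoretic section `prodTowerSection`. The input of the `lim¹` sequence on `X_proét`.
[cite: BhattScholze2015, Prop. 3.1.10 (proof) and Lemma 6.8.2] -/
theorem isContinuousShortExact_toZModPowProd :
    IsContinuousShortExact (toZModPowProd ℓ) (prodTowerDiff ℓ) where
  continuous_left := continuous_toZModPowProd ℓ
  continuous_right := continuous_prodTowerDiff ℓ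
  injective := toZModPowProd_injective ℓ
  isInducing := ((continuous_toZModPowProd ℓ).isClosedEmbedding (toZModPowProd_injective ℓ)).isInducing
  comp_eq_zero := prodTowerDiff_comp_toZModPowProd ℓ
  exact _ hb := exists_toZModPowProd_eq_of_prodTowerDiff_eq_zero ℓ hb
  exists_section := ⟨prodTowerSection ℓ, continuous_prodTowerSection ℓ, prodTowerDiff_prodTowerSection ℓ⟩

end Coefficients

section Sheaves

variable (X : Scheme.{u}) (ℓ : ℕ) [Fact ℓ.Prime]

/-- **The product coefficient sequence** `F_{ℤ_ℓ} —ι→ F_{∏ℤ/ℓᵐ} —τ→ F_{∏ℤ/ℓᵐ}` of abelian sheaves on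
`X_proét` (`proetSheafShortComplex` of `ι`, `τ`): the sheaf version of
`lim F_n → ∏ F_n —(t - id)→ ∏ F_n` (Bhatt–Scholze, proof of Prop. 3.1.10) for the tower `F_{ℤ/ℓⁿ}` with
`lim_n F_{ℤ/ℓⁿ} = F_{ℤ_ℓ}` (Lemma 6.8.2 (1)), `∏_n F_{ℤ/ℓⁿ}` realised as the sheaf of continuous maps to
the product group. [cite: BhattScholze2015, Prop. 3.1.10 (proof) and Lemma 6.8.2] -/
abbrev prodShortComplex : ShortComplex (Sheaf (Scheme.ProEt.topology X) Ab.{u + 1}) :=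
  proetSheafShortComplex X (toZModPowProd ℓ) (continuous_toZModPowProd ℓ) (prodTowerDiff ℓ)
    (continuous_prodTowerDiff ℓ) (prodTowerDiff_comp_toZModPowProd ℓ)

/-- **`0 → F_{ℤ_ℓ} → F_{∏ℤ/ℓᵐ} —(1 - shift)→ F_{∏ℤ/ℓᵐ} → 0` is a short exact sequence of abelian sheaves
on `X_proét`** — unconditionally for Mathlib's pro-étale site (`proetSheaf_shortExact` of
`isContinuousShortExact_toZModPowProd`: exact on sections over every object). The sheaf-level
input of the `lim¹` sequence of Bhatt–Scholze Prop. 5.6.2 for `(ℤ/ℓᵐ)_m`.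
[cite: BhattScholze2015, Prop. 3.1.10 (proof) and Prop. 5.6.2] -/
theorem prodShortComplex_shortExact : (prodShortComplex X ℓ).ShortExact :=
  proetSheaf_shortExact X (isContinuousShortExact_toZModPowProd ℓ)

end Sheaves

end Literature.AlgebraicGeometry.Motives

end
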